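import Summits.SmoothPoincare4.SmoothPoincare4.Theorems.SymplecticOrigamiOrigamiFoldExistenceStubOuterCleanRecognitionChartChimney

/-!
# Stub `stub_outerSideLemma` of line `shadow-pleats` for crux `OrigamiFoldExistence` — δ:
# from the exterior of the lifted crease to the unbounded connected set of `OuterSideLemma`
(item stmt-SmoothPoincare4-7844, route SymplecticOrigami; seat c5, complementary lead on O1)

WHAT.  `exists_W_of_mem_exterior`: for tube data `D` of the lifted outer crease
`f = λ ∘ radialSphere G 2 : S³ → S⁴` (`λ = liftS4`, inverse stereographic projection from the
north pole `N`; `range f = λ(G(S(0,2)))`) and a point `y ∈ ℝ⁴` whose lift `λ y` lies in the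
exterior `exterior D = {0 < sideσ D} ∋ N` of the crease, there is a CONNECTED, UNBOUNDED subset
`W ∋ y` of `ℝ⁴` missing the outer crease `G(S(0,2))` — namely `W := λ⁻¹(exterior D)`, the
unbounded complementary component of the crease.

FROM WHAT (file A `…StubOuterCleanRecognitionChartChimney`): `exterior`, `isConnected_exterior`,
`northPole_mem_exterior`, `disjoint_exterior_range`, `compl_closure_chimney`,
`isBounded_preimage_liftS4_closure_chimney`, `range_liftS4`, `liftS4_injective`,
`liftS4_ne_northPole`, `range_radialSphere_two`; plus two point-set lemmas proved here:
* `isPreconnected_diff_singleton_of_nhds` — PUNCTURE LEMMA: in a `T₁` space, `U ∖ {p}` is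
  preconnected if `U` is and `p` has an open neighbourhood `B ⊆ U` with preconnected puncture;
* `isPreconnected_compl_closedBall_four` — `ℝ⁴ ∖ B̄(0,t)` is preconnected (scaling image of
  `S(0,1) × (t, ∞)`; adapted from the tree's `AnnulusPairConnectivity`).
The proof: `y ∈ W` is the hypothesis; `W` misses `G(S(0,2)) = range (radialSphere G 2)` because
the exterior misses `range f`; `ℝ⁴ ∖ W = λ⁻¹(closure chimney)` is bounded, so `W` is not (else
`ℝ⁴` would be) and `W ⊇ ℝ⁴ ∖ B̄(0,R)` for some `R`; finally `W = λ⁻¹(exterior D ∖ {N})` with `λ`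
an injective open map onto `S⁴ ∖ {N}`, and `exterior D ∖ {N}` is preconnected by the puncture
lemma applied to the open neighbourhood `B = S⁴ ∖ λ(B̄(0,R))` of `N`, whose puncture
`λ(ℝ⁴ ∖ B̄(0,R))` is preconnected.

WHY.  It is the last step of file ε (the lead's assembly of `stub_outerSideLemma`): O1
`OuterSideLemma` (`…ChartSide`) asks, for a collar point `u`, for exactly such a `W ∋ G u`, and
the lead shows `λ (G u) ∈ exterior D`.  Sources: the lead's `SideLemma-covering-c5.md` §5.
-/

noncomputable section

-- the prescribed namespace `Summit.<P>.<Sub>.…` duplicates `SmoothPoincare4` (P = Sub)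
set_option linter.dupNamespace false

open scoped Manifold ContDiff Topology
open Set Function Filter Metric
open Literature.Topology.FourManifolds Literature.Topology.FourManifolds.SphereHypersurfaceSides

namespace Summit.SmoothPoincare4.SmoothPoincare4.Theorems.OrigamiFoldExistence.ShadowPleats

/-! ### Point-set topology: puncturing a connected set, the outside of a ball -/

/-- **Puncture lemma.**  In a `T₁` space, removing a point `p` from a preconnected set `U` keeps
it preconnected as soon as `p` has an open neighbourhood `B ⊆ U` whose puncture `B ∖ {p}` is
preconnected: a separation `u ⊔ v` of `U ∖ {p}` with, say, `B ∖ {p} ⊆ u` would yield the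
separation `(u ∪ B) ⊔ (v ∖ {p})` of `U`. -/
theorem isPreconnected_diff_singleton_of_nhds {X : Type*} [TopologicalSpace X] [T1Space X]
    {U B : Set X} {p : X} (hU : IsPreconnected U) (hB : IsOpen B) (hpB : p ∈ B) (hBU : B ⊆ U)
    (hBp : IsPreconnected (B \ {p})) : IsPreconnected (U \ {p}) := by
  rw [isPreconnected_iff_subset_of_disjoint] at hU hBp ⊢
  -- half of the argument: if `B ∖ {p} ⊆ u` then `U ∖ {p} ⊆ u`
  have key : ∀ u v : Set X, IsOpen u → IsOpen v → U \ {p} ⊆ u ∪ v → (U \ {p}) ∩ (u ∩ v) = ∅ →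
      B \ {p} ⊆ u → U \ {p} ⊆ u := by
    intro u v hu hv huv hdisj hBu
    have hcover : U ⊆ (u ∪ B) ∪ (v \ {p}) := by
      intro x hx
      by_cases hxp : x = p
      · exact Or.inl (Or.inr (hxp ▸ hpB))
      · rcases huv ⟨hx, hxp⟩ with h | h
        · exact Or.inl (Or.inl h)
        · exact Or.inr ⟨h, hxp⟩
    have hdisj' : U ∩ ((u ∪ B) ∩ (v \ {p})) = ∅ := by
      refine Set.eq_empty_of_forall_notMem fun x ⟨hx, hxuB, hxv, hxp⟩ => ?_
      have hxu : x ∈ u := hxuB.elim id fun hxB => hBu ⟨hxB, hxp⟩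
      have hx' : x ∈ (U \ {p}) ∩ (u ∩ v) := ⟨⟨hx, hxp⟩, hxu, hxv⟩
      rw [hdisj] at hx'
      exact hx'
    rcases hU _ _ (hu.union hB) (hv.sdiff isClosed_singleton) hcover hdisj' with h | h
    · intro x hx
      rcases h hx.1 with hxu | hxB
      · exact hxu
      · exact hBu ⟨hxB, hx.2⟩
    · exact absurd (mem_singleton p) (h (hBU hpB)).2
  intro u v hu hv huv hdisj
  have hBuv : B \ {p} ⊆ u ∪ v := (sdiff_subset_sdiff_left hBU).trans huv
  have hBdisj : (B \ {p}) ∩ (u ∩ v) = ∅ := by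
    rw [← Set.subset_empty_iff, ← hdisj]
    exact Set.inter_subset_inter_left _ (sdiff_subset_sdiff_left hBU)
  rcases hBp u v hu hv hBuv hBdisj with h | h
  · exact Or.inl (key u v hu hv huv hdisj h)
  · exact Or.inr (key v u hv hu (by rwa [union_comm]) (by rwa [inter_comm v u]) h)

-- adapted from `Literature.Topology.FourManifolds.isPreconnected_compl_closedBall_zero`
-- (`Literature/Topology/FourManifolds/AnnulusPairConnectivity.lean`, not imported here)
/-- The complement of a closed ball about the origin of `ℝ⁴` is preconnected: for `t ≥ 0` it
is the image of the connected set `S(0,1) × (t, ∞)` under scaling `(w, c) ↦ c • w`. -/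
theorem isPreconnected_compl_closedBall_four (t : ℝ) :
    IsPreconnected (closedBall (0 : EuclideanSpace ℝ (Fin 4)) t)ᶜ := by
  rcases lt_or_ge t 0 with ht | ht
  · rw [Metric.closedBall_eq_empty.2 ht, compl_empty]
    exact isPreconnected_univ
  have hrank : 1 < Module.rank ℝ (EuclideanSpace ℝ (Fin 4)) := by
    rw [← Module.finrank_eq_rank, finrank_euclideanSpace_fin]
    norm_num
  have heq : (closedBall (0 : EuclideanSpace ℝ (Fin 4)) t)ᶜ =
      (fun p : EuclideanSpace ℝ (Fin 4) × ℝ => p.2 • p.1) ''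
        (sphere (0 : EuclideanSpace ℝ (Fin 4)) 1 ×ˢ Ioi t) := by
    ext x
    simp only [mem_compl_iff, mem_closedBall_zero_iff, not_le, mem_image, mem_prod,
      mem_sphere_zero_iff_norm, mem_Ioi, Prod.exists]
    constructor
    · intro h1
      have hx0 : ‖x‖ ≠ 0 := by linarith
      refine ⟨‖x‖⁻¹ • x, ‖x‖, ⟨?_, h1⟩, ?_⟩
      · rw [norm_smul, norm_inv, norm_norm, inv_mul_cancel₀ hx0]
      · rw [smul_smul, mul_inv_cancel₀ hx0, one_smul]
    · rintro ⟨w, c, ⟨hw, hc⟩, rfl⟩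
      rw [norm_smul, Real.norm_of_nonneg (ht.trans hc.le), hw, mul_one]
      exact hc
  rw [heq]
  exact ((isConnected_sphere hrank 0 zero_le_one).isPreconnected.prod isPreconnected_Ioi).image _
    (continuous_snd.smul continuous_fst).continuousOn

/-! ### The registered helper -/

/-- **From the exterior to the unbounded component.**  If the lift `λ y` of a point `y ∈ ℝ⁴`
lies in the exterior of the lifted sphere `λ(G(S(0,2)))`, then `y` lies in an unbounded
connected subset of `ℝ⁴` missing `G(S(0,2))` — namely `W = λ⁻¹(exterior)`: it misses the crease
because the exterior does, its complement `λ⁻¹(closure chimney)` is bounded (so `W` is not, and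
`W` contains the outside of a ball `B̄(0,R)`), and `W = λ⁻¹(exterior ∖ {N})` is preconnected
because `λ` is an injective open map onto `S⁴ ∖ {N}` and `exterior ∖ {N}` is preconnected by the
puncture lemma at the open neighbourhood `S⁴ ∖ λ(B̄(0,R))` of `N`. [folklore] -/
theorem exists_W_of_mem_exterior {G : EuclideanSpace ℝ (Fin 4) → EuclideanSpace ℝ (Fin 4)}
    (D : TubeData (liftS4 ∘ radialSphere G 2)) {y : EuclideanSpace ℝ (Fin 4)} (hy : liftS4 y ∈ exterior D) :
    ∃ W : Set (EuclideanSpace ℝ (Fin 4)), IsConnected W ∧ y ∈ W ∧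
      Disjoint W (G '' Metric.sphere 0 2) ∧ ¬ Bornology.IsBounded W := by
  -- the north pole is off the lifted crease
  have hN : northPole ∉ range (liftS4 ∘ radialSphere G 2) := by
    rintro ⟨x, hx⟩
    exact liftS4_ne_northPole _ hx
  -- off `λ⁻¹(closure chimney)` (a bounded set) the lift is exterior
  have hcompl : ∀ x, liftS4 x ∉ closure (chimney D) → liftS4 x ∈ exterior D := fun x hx => by
    rw [← compl_closure_chimney D hN]
    exact hx
  obtain ⟨R, hR⟩ := (isBounded_preimage_liftS4_closure_chimney D hN).subset_closedBall 0
  have hfar : (closedBall (0 : EuclideanSpace ℝ (Fin 4)) R)ᶜ ⊆ liftS4 ⁻¹' exterior D :=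
    fun x hx => hcompl x fun h => hx (hR h)
  refine ⟨liftS4 ⁻¹' exterior D, ⟨⟨y, hy⟩, ?_⟩, hy, ?_, ?_⟩
  · -- CONNECTED: `W = λ⁻¹(exterior ∖ {N})` and `exterior ∖ {N}` is preconnected
    have hK : IsCompact (liftS4 '' closedBall (0 : EuclideanSpace ℝ (Fin 4)) R) :=
      (isCompact_closedBall (0 : EuclideanSpace ℝ (Fin 4)) R).image contMDiff_liftS4.continuous
    -- the puncture of the open neighbourhood `B = S⁴ ∖ λ(B̄(0,R))` of `N` is `λ(ℝ⁴ ∖ B̄(0,R))`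
    have hBdiff : (liftS4 '' closedBall (0 : EuclideanSpace ℝ (Fin 4)) R)ᶜ \ {northPole} =
        liftS4 '' (closedBall (0 : EuclideanSpace ℝ (Fin 4)) R)ᶜ := by
      ext z
      constructor
      · rintro ⟨hz, hzN⟩
        obtain ⟨x, rfl⟩ : z ∈ range liftS4 := by
          rw [range_liftS4]
          exact hzN
        exact ⟨x, fun hx => hz ⟨x, hx, rfl⟩, rfl⟩
      · rintro ⟨x, hx, rfl⟩
        exact ⟨fun ⟨x', hx', hxx'⟩ => hx (liftS4_injective hxx' ▸ hx'), liftS4_ne_northPole x⟩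
    have hE : IsPreconnected (exterior D \ {northPole}) := by
      refine isPreconnected_diff_singleton_of_nhds (isConnected_exterior D hN).isPreconnected
        hK.isClosed.isOpen_compl ?_ ?_ ?_
      · rintro ⟨x, -, hx⟩
        exact liftS4_ne_northPole x hx
      · intro z hz
        by_cases hzN : z = northPole
        · rw [hzN]
          exact northPole_mem_exterior D hN
        · have hz' : z ∈ liftS4 '' (closedBall (0 : EuclideanSpace ℝ (Fin 4)) R)ᶜ := by
            rw [← hBdiff]
            exact ⟨hz, hzN⟩
          obtain ⟨x, hx, rfl⟩ := hz'
          exact hfar hx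
      · rw [hBdiff]
        exact (isPreconnected_compl_closedBall_four R).image _
          contMDiff_liftS4.continuous.continuousOn
    have hWeq : liftS4 ⁻¹' exterior D = liftS4 ⁻¹' (exterior D \ {northPole}) := by
      ext x
      exact ⟨fun hx => ⟨hx, liftS4_ne_northPole x⟩, fun hx => hx.1⟩
    rw [hWeq]
    refine hE.preimage_of_isOpenMap liftS4_injective (fun t ht => ?_) ?_
    · -- `λ = σ_N⁻¹` is an open map
      exact (stereographic' 4 northPole).isOpen_image_symm_of_subset_target ht
        (by rw [stereographic'_target]; exact subset_univ _)
    · rw [range_liftS4]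
      exact fun z hz => hz.2
  · -- DISJOINT from the crease `G(S(0,2)) = range (radialSphere G 2)`: the exterior misses `range f`
    refine Set.disjoint_left.2 fun x (hx : liftS4 x ∈ exterior D) hx' => ?_
    rw [← range_radialSphere_two] at hx'
    obtain ⟨θ, rfl⟩ := hx'
    exact Set.disjoint_left.1 (disjoint_exterior_range D hN) hx ⟨θ, rfl⟩
  · -- UNBOUNDED: the complement `λ⁻¹(closure chimney)` is bounded and `ℝ⁴` is not
    intro hb
    refine NormedSpace.unbounded_univ ℝ (EuclideanSpace ℝ (Fin 4)) ?_
    refine (hb.union (isBounded_preimage_liftS4_closure_chimney D hN)).subset fun x _ => ?_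
    by_cases hx : liftS4 x ∈ closure (chimney D)
    · exact Or.inr hx
    · exact Or.inl (hcompl x hx)

end Summit.SmoothPoincare4.SmoothPoincare4.Theorems.OrigamiFoldExistence.ShadowPleats

end
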